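import Summits.CriticalPhenomena.SAWScalingLimit.Theorems.SAWLeftRightFKGLeftRightFKGDefs
import Summits.CriticalPhenomena.SAWScalingLimit.Theorems.SAWLeftRightFKGLeftRightFKGStubMeshReduction
import Summits.CriticalPhenomena.SAWScalingLimit.Theorems.LeftRightFKG.Negative.OrderCharacterisation
import HarnessLib

/-!
# Stub `stub_stepMonotone` of line `corner-localisation`, helper file 1: crossing formulas

Crux `LeftRightFKG` (stmt-CriticalPhenomena-11232), vocabulary module
`Summits.CriticalPhenomena.SAWScalingLimit.Theorems.SAWLeftRightFKGLeftRightFKGDefs`.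

General facts about closed walks `w` of a lattice subgraph `G ≤ ℤ²` and the winding number
`W(m,k) = wind(w - probeL m k)` of their polyline about the centre of the face `(m, k)`:

* `wind_loop_probeL`: `W(m,k) = -Σ_{darts d of w} edgeCross m k d` (the vertical probe of
  `Negative.LatticePolylines`, as a dart sum);
* `wind_loop_probeL_rot`: the same with the HORIZONTAL count, obtained from the vertical formula
  applied to the quarter-turned polyline (`v ↦ (-v₁, v₀)`, i.e. multiplication by `i`, which
  preserves winding numbers): `W(m,k) = -Σ_d edgeCross (-k-1) m (ρ d.fst) (ρ d.snd)`;
* dart bookkeeping for lenses `γ₁ · γ₂⁻¹` of two paths sharing their first `k + 1` vertices: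
  the jump of `W` across the edge `{p, X}` at `p = γᵢ(k)` is `[γ₁(k+1) = X] - [γ₂(k+1) = X]`
  (`lens_jump`), and the four pointwise identities of crossing functionals at the four edges at `p`.
-/

noncomputable section

open Set Complex Literature.Probability.LatticeModels Literature.Probability.RandomPlanarGeometry
open Literature.Topology.PlaneTopology
open Summit.CriticalPhenomena.SAWScalingLimit.Theorems.LeftRightFKG.Negative

namespace Summit.CriticalPhenomena.SAWScalingLimit.Theorems.LeftRightFKG.CornerLoc

namespace StepMono

/-! ## Small helpers -/

/-- A site equals `bx i j` iff its coordinates are `i`, `j`. [folklore] -/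
theorem eq_bx_iff (v : Site 2) (i j : ℤ) : v = bx i j ↔ v 0 = i ∧ v 1 = j := by
  constructor
  · rintro rfl
    exact ⟨rfl, rfl⟩
  · rintro ⟨h0, h1⟩
    rw [eq_bx v, h0, h1]

/-- Upper bounds for a coordinate along a finite list of sites. [folklore] -/
theorem exists_upper_bound (l : List (Site 2)) (i : Fin 2) (k : ℤ) :
    ∃ Y : ℤ, k ≤ Y ∧ ∀ x ∈ l, x i ≤ Y := by
  induction l with
  | nil => exact ⟨k, le_rfl, fun x hx => by simp at hx⟩
  | cons a l ih =>
    obtain ⟨Y, hkY, hY⟩ := ih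
    refine ⟨max Y (a i), hkY.trans (le_max_left _ _), fun x hx => ?_⟩
    rcases List.mem_cons.1 hx with rfl | hx
    · exact le_max_right _ _
    · exact (hY x hx).trans (le_max_left _ _)

/-- `Σ (-f) = -Σ f` along a list. [folklore] -/
theorem sum_map_neg {α : Type*} (l : List α) (f : α → ℤ) :
    (l.map fun x => -f x).sum = -(l.map f).sum := by
  induction l with
  | nil => simp
  | cons a t ih => simp only [List.map_cons, List.sum_cons, ih]; ring

/-- `Σ (f - g) = Σ f - Σ g` along a list. [folklore] -/
theorem sum_map_sub {α : Type*} (l : List α) (f g : α → ℤ) :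
    (l.map fun x => f x - g x).sum = (l.map f).sum - (l.map g).sum := by
  induction l with
  | nil => simp
  | cons a t ih => simp only [List.map_cons, List.sum_cons, ih]; ring

/-! ## The vertical probe formula as a dart sum -/

variable {G : SimpleGraph (Site 2)}

/-- **Vertical probe formula**: the winding number of the polyline of a closed walk of a lattice
subgraph about the centre of the face `(m, k)` is minus the signed count of its darts crossing the
upward probe (`wind_poly_probeL` with a large enough ceiling `Y`). [folklore] -/
theorem wind_loop_probeL (hG : ∀ x y, G.Adj x y → (zdGraph 2).Adj x y) {u : Site 2}
    (w : G.Walk u u) (m k : ℤ) :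
    wind (fun t : ℝ => IccExtend zero_le_one (w.toCurve (meshPoint 1)) t - probeL m k) =
      -(w.darts.map fun d => edgeCross m k d.fst d.snd).sum := by
  obtain ⟨Y, hkY, hY⟩ := exists_upper_bound w.support 1 k
  simp only [iccExtend_toCurve_apply]
  have key := wind_poly_probeL (m := m) hkY u w.support.tail (isChain_support hG w)
    (hY u w.start_mem_support) (fun x hx => hY x (List.mem_of_mem_tail hx)) (poly_fst_walk w)
  rw [← wcross_eq_darts]
  unfold wcross
  exact_mod_cast key

/-! ## The quarter turn and the horizontal probe formula -/

/-- The quarter turn `v ↦ (-v₁, v₀)` of a site is multiplication by `i` in the plane. [folklore] -/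
theorem pt_rot (v : Site 2) : pt (bx (-v 1) (v 0)) = I * pt v := by
  apply Complex.ext
  · simp
  · simp

/-- The quarter turn preserves lattice adjacency. [folklore] -/
theorem adj_rot {x y : Site 2} (h : (zdGraph 2).Adj x y) :
    (zdGraph 2).Adj (bx (-x 1) (x 0)) (bx (-y 1) (y 0)) := by
  apply adj_bx
  rcases adj_cases h with ⟨h0, h1⟩ | ⟨h0, h1⟩ | ⟨h1, h0⟩ | ⟨h1, h0⟩ <;> omega

/-- Polylines through quarter-turned sites are quarter-turned polylines (real-affine
equivariance of `polylineFrom`). [folklore] -/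
theorem poly_rot_apply (a : Site 2) (l : List (Site 2)) (t : unitInterval) :
    (poly (bx (-a 1) (a 0)) (l.map fun v => bx (-v 1) (v 0))) t = I * (poly a l) t := by
  have key := Polyline.polylineFrom_map_apply (LinearMap.mulLeft ℝ I).toAffineMap (l.map pt)
    (pt a) t
  have h2 : (l.map fun v => bx (-v 1) (v 0)).map pt =
      (l.map pt).map (LinearMap.mulLeft ℝ I).toAffineMap := by
    simp only [List.map_map]
    refine List.map_congr_left fun v _ => ?_
    simp only [Function.comp_apply, pt_rot, LinearMap.coe_toAffineMap, LinearMap.mulLeft_apply]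
  have h3 : pt (bx (-a 1) (a 0)) = (LinearMap.mulLeft ℝ I).toAffineMap (pt a) := by
    rw [pt_rot]; simp
  unfold poly
  rw [h2, h3, key]
  simp

/-- `i · probeL m k = probeL (-k-1) m`. [folklore] -/
theorem I_mul_probeL (m k : ℤ) : I * probeL m k = probeL (-k - 1) m := by
  apply Complex.ext
  · simp [probeL]; ring
  · simp [probeL]

/-- The signed crossing count of the image of a walk under a map of sites, as a dart sum.
[folklore] -/
theorem pathCross_map_eq_darts (f : Site 2 → Site 2) (M K : ℤ) :
    ∀ {u v : Site 2} (w : G.Walk u v),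
      pathCross M K (f u) (w.support.tail.map f) =
        (w.darts.map fun d => edgeCross M K (f d.fst) (f d.snd)).sum
  | _, _, SimpleGraph.Walk.nil => by simp
  | u, _, SimpleGraph.Walk.cons (v := v') h p => by
    rw [SimpleGraph.Walk.support_cons, List.tail_cons, ← p.cons_tail_support, List.map_cons,
      pathCross_cons, SimpleGraph.Walk.darts_cons, List.map_cons, List.sum_cons,
      pathCross_map_eq_darts f M K p]

/-- **Horizontal probe formula**: the winding number of the polyline of a closed walk of a lattice
subgraph about the centre of the face `(m, k)` is minus the vertical-probe count of the
QUARTER-TURNED walk, i.e. `+1` for each northward dart `(x, k) → (x, k+1)` with `x ≥ m + 1` and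
`-1` for each southward one (multiplication by `i` preserves winding numbers and maps the face
centre `probeL m k` to `probeL (-k-1) m`). [folklore] -/
theorem wind_loop_probeL_rot (hG : ∀ x y, G.Adj x y → (zdGraph 2).Adj x y) {u : Site 2}
    (w : G.Walk u u) (m k : ℤ) :
    wind (fun t : ℝ => IccExtend zero_le_one (w.toCurve (meshPoint 1)) t - probeL m k) =
      -(w.darts.map fun d =>
        edgeCross (-k - 1) m (bx (-d.fst 1) (d.fst 0)) (bx (-d.snd 1) (d.snd 0))).sum := by
  obtain ⟨Y, hmY, hY⟩ := exists_upper_bound w.support 0 m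
  simp only [iccExtend_toCurve_apply]
  set ρ : Site 2 → Site 2 := fun v => bx (-v 1) (v 0) with hρ
  have hchain : List.IsChain (zdGraph 2).Adj (ρ u :: w.support.tail.map ρ) :=
    List.isChain_map_of_isChain ρ (fun _ _ h => adj_rot h) (isChain_support hG w)
  have hend : (polylineFrom (pt (ρ u)) ((w.support.tail.map ρ).map pt)).1 = pt (ρ u) := by
    rw [polylineFrom_fst]
    have : pt (ρ u) :: (w.support.tail.map ρ).map pt =
        (u :: w.support.tail).map (fun v => pt (ρ v)) := by
      rw [List.map_cons, List.map_map]
      rfl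
    rw [w.cons_tail_support] at this
    simp only [this, List.getLast_map, SimpleGraph.Walk.getLast_support]
  have key := wind_poly_probeL (m := -k - 1) (k := m) hmY (ρ u) (w.support.tail.map ρ) hchain
    (by simpa [hρ] using hY u w.start_mem_support)
    (fun x hx => by
      obtain ⟨y, hy, rfl⟩ := List.mem_map.1 hx
      simpa [hρ] using hY y (List.mem_of_mem_tail hy)) hend
  rw [pathCross_map_eq_darts ρ] at key
  have hfun : (fun t : ℝ => (poly u w.support.tail).extend t - probeL m k) =
      fun t => I⁻¹ * ((poly (ρ u) (w.support.tail.map ρ)).extend t - probeL (-k - 1) m) := by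
    funext t
    have hI : (poly (ρ u) (w.support.tail.map ρ)).extend t =
        I * (poly u w.support.tail).extend t :=
      poly_rot_apply u w.support.tail _
    rw [← I_mul_probeL, hI, ← mul_sub, ← mul_assoc, inv_mul_cancel₀ I_ne_zero, one_mul]
  rw [hfun, wind_const_mul (inv_ne_zero I_ne_zero)]
  exact_mod_cast key

/-! ## Dart bookkeeping for paths and lenses -/

/-- In a path, the only dart out of the `k`-th vertex `p` (`k < length`) goes to the `(k+1)`-st
vertex. [folklore] -/
theorem sum_ind_out (X : Site 2) : ∀ {a b : Site 2} (γ : G.Walk a b), γ.IsPath →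
    ∀ (k : ℕ) (p : Site 2), k < γ.length → γ.getVert k = p →
      (γ.darts.map fun d => if d.fst = p ∧ d.snd = X then (1 : ℤ) else 0).sum =
        if γ.getVert (k + 1) = X then 1 else 0
  | _, _, SimpleGraph.Walk.nil, _, _, _, hk, _ => by simp at hk
  | u, _, SimpleGraph.Walk.cons (v := v) h q, hp, 0, p, _, hp0 => by
    rw [SimpleGraph.Walk.cons_isPath_iff] at hp
    rw [SimpleGraph.Walk.getVert_zero] at hp0
    subst hp0
    have h0 : ∀ d ∈ q.darts, (if d.fst = u ∧ d.snd = X then (1 : ℤ) else 0) = 0 :=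
      fun d hd => if_neg fun hc : d.fst = u ∧ d.snd = X =>
        hp.2 (hc.1 ▸ q.dart_fst_mem_support_of_mem_darts hd)
    simp only [SimpleGraph.Walk.darts_cons, List.map_cons, List.sum_cons,
      zero_add, SimpleGraph.Walk.getVert_cons_succ, SimpleGraph.Walk.getVert_zero,
      List.map_congr_left h0, true_and]
    simp
  | u, _, SimpleGraph.Walk.cons (v := v) h q, hp, k + 1, p, hk, hpk => by
    rw [SimpleGraph.Walk.cons_isPath_iff] at hp
    rw [SimpleGraph.Walk.length_cons] at hk
    rw [SimpleGraph.Walk.getVert_cons_succ] at hpk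
    have hk' : k < q.length := by omega
    simp only [SimpleGraph.Walk.darts_cons, List.map_cons, List.sum_cons,
      SimpleGraph.Walk.getVert_cons_succ]
    rw [sum_ind_out X q hp.1 k p hk' hpk, if_neg]
    · simp
    · rintro ⟨hu, -⟩
      exact hp.2 (hu ▸ hpk ▸ q.getVert_mem_support k)

/-- In a path, the only dart into the `k`-th vertex `p` (`k < length`) comes from the `(k-1)`-st
vertex, and there is none for `k = 0`. [folklore] -/
theorem sum_ind_in (X : Site 2) : ∀ {a b : Site 2} (γ : G.Walk a b), γ.IsPath →
    ∀ (k : ℕ) (p : Site 2), k < γ.length → γ.getVert k = p →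
      (γ.darts.map fun d => if d.fst = X ∧ d.snd = p then (1 : ℤ) else 0).sum =
        if 0 < k ∧ γ.getVert (k - 1) = X then 1 else 0
  | _, _, SimpleGraph.Walk.nil, _, _, _, hk, _ => by simp at hk
  | u, _, SimpleGraph.Walk.cons (v := v) h q, hp, 0, p, _, hp0 => by
    rw [SimpleGraph.Walk.cons_isPath_iff] at hp
    rw [SimpleGraph.Walk.getVert_zero] at hp0
    subst hp0
    have h0 : ∀ d ∈ q.darts, (if d.fst = X ∧ d.snd = u then (1 : ℤ) else 0) = 0 :=
      fun d hd => if_neg fun hc : d.fst = X ∧ d.snd = u =>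
        hp.2 (hc.2 ▸ q.dart_snd_mem_support_of_mem_darts hd)
    simp only [SimpleGraph.Walk.darts_cons, List.map_cons, List.sum_cons,
      List.map_congr_left h0, lt_irrefl, false_and, if_false]
    rw [if_neg]
    · simp
    · rintro ⟨-, hv⟩
      exact h.ne hv.symm
  | u, _, SimpleGraph.Walk.cons (v := v) h q, hp, k + 1, p, hk, hpk => by
    rw [SimpleGraph.Walk.cons_isPath_iff] at hp
    rw [SimpleGraph.Walk.length_cons] at hk
    rw [SimpleGraph.Walk.getVert_cons_succ] at hpk
    have hk' : k < q.length := by omega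
    simp only [SimpleGraph.Walk.darts_cons, List.map_cons, List.sum_cons,
      Nat.add_sub_cancel, Nat.zero_lt_succ, true_and]
    rw [sum_ind_in X q hp.1 k p hk' hpk]
    rcases Nat.eq_zero_or_pos k with rfl | hkpos
    · rw [SimpleGraph.Walk.getVert_zero] at hpk
      subst hpk
      simp
    · rw [if_neg, SimpleGraph.Walk.getVert_cons q h hkpos.ne']
      · simp [hkpos]
      · rintro ⟨-, hv⟩
        have := (hp.1.getVert_eq_start_iff hk'.le).1 (hpk.trans hv.symm)
        omega

/-- Dart sums of an antisymmetric functional over a lens `γ₁ · γ₂⁻¹`. [folklore] -/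
theorem sum_lens_darts {a b : Site 2} (γ₁ γ₂ : G.Walk a b) (φ : Site 2 → Site 2 → ℤ)
    (hφ : ∀ x y, φ y x = -φ x y) :
    ((γ₁.append γ₂.reverse).darts.map fun d => φ d.fst d.snd).sum =
      (γ₁.darts.map fun d => φ d.fst d.snd).sum - (γ₂.darts.map fun d => φ d.fst d.snd).sum := by
  simp only [SimpleGraph.Walk.darts_append, SimpleGraph.Walk.darts_reverse, List.map_append,
    List.sum_append, List.map_reverse, List.sum_reverse, List.map_map]
  have : (fun d : G.Dart => φ d.fst d.snd) ∘ SimpleGraph.Dart.symm = fun d => -φ d.fst d.snd := by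
    funext d
    simp only [Function.comp_apply, SimpleGraph.Dart.symm_toProd, Prod.fst_swap, Prod.snd_swap]
    exact hφ d.fst d.snd
  rw [this, sum_map_neg, sub_eq_add_neg]

/-- **Jump of a dart sum across the edge `{p, X}` at the branch point.** For two paths `γ₁`, `γ₂`
from `a` to `b` sharing their first `k + 1` vertices (`k <` both lengths, `p = γᵢ(k)`), and two
antisymmetric functionals `φ`, `ψ` whose difference is the indicator of the dart `p → X` minus the
indicator of the dart `X → p`: the difference of their lens sums is `[γ₁(k+1) = X] - [γ₂(k+1) = X]`
(the darts into `p` are the same for both paths and cancel). [folklore] -/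
theorem lens_jump {a b : Site 2} {γ₁ γ₂ : G.Walk a b} (h₁ : γ₁.IsPath) (h₂ : γ₂.IsPath) {k : ℕ}
    (hk : ∀ i ≤ k, γ₁.getVert i = γ₂.getVert i) (hk₁ : k < γ₁.length) (hk₂ : k < γ₂.length)
    (φ ψ : Site 2 → Site 2 → ℤ) (hφ : ∀ x y, φ y x = -φ x y) (hψ : ∀ x y, ψ y x = -ψ x y)
    (X : Site 2)
    (hd : ∀ x y, φ x y - ψ x y =
      (if x = γ₁.getVert k ∧ y = X then 1 else 0) - (if x = X ∧ y = γ₁.getVert k then 1 else 0)) :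
    ((γ₁.append γ₂.reverse).darts.map fun d => φ d.fst d.snd).sum -
        ((γ₁.append γ₂.reverse).darts.map fun d => ψ d.fst d.snd).sum =
      (if γ₁.getVert (k + 1) = X then 1 else 0) - (if γ₂.getVert (k + 1) = X then 1 else 0) := by
  rw [sum_lens_darts γ₁ γ₂ φ hφ, sum_lens_darts γ₁ γ₂ ψ hψ]
  have e₁ : (γ₁.darts.map fun d => φ d.fst d.snd).sum - (γ₁.darts.map fun d => ψ d.fst d.snd).sum =
      (if γ₁.getVert (k + 1) = X then 1 else 0) -
        (if 0 < k ∧ γ₁.getVert (k - 1) = X then 1 else 0) := by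
    rw [← sum_map_sub, ← sum_ind_out X γ₁ h₁ k _ hk₁ rfl, ← sum_ind_in X γ₁ h₁ k _ hk₁ rfl,
      ← sum_map_sub]
    exact congrArg List.sum (List.map_congr_left fun d _ => hd d.fst d.snd)
  have e₂ : (γ₂.darts.map fun d => φ d.fst d.snd).sum - (γ₂.darts.map fun d => ψ d.fst d.snd).sum =
      (if γ₂.getVert (k + 1) = X then 1 else 0) -
        (if 0 < k ∧ γ₂.getVert (k - 1) = X then 1 else 0) := by
    rw [← sum_map_sub, ← sum_ind_out X γ₂ h₂ k _ hk₂ (hk k le_rfl).symm,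
      ← sum_ind_in X γ₂ h₂ k _ hk₂ (hk k le_rfl).symm, ← sum_map_sub]
    exact congrArg List.sum (List.map_congr_left fun d _ => hd d.fst d.snd)
  have e₃ : γ₁.getVert (k - 1) = γ₂.getVert (k - 1) := hk (k - 1) (Nat.sub_le k 1)
  rw [e₃] at e₁
  omega

/-- **The reduced lens.** For two walks sharing their first `k + 1` vertices, the lens sum of an
antisymmetric functional equals the sum over the REDUCED lens `γ₁[k..] · γ₂[k..]⁻¹` (the darts of
the common prefix cancel). [folklore] -/
theorem sum_lens_eq_sum_reduced {a b : Site 2} (γ₁ γ₂ : G.Walk a b) {k : ℕ}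
    (hk : ∀ i ≤ k, γ₁.getVert i = γ₂.getVert i) (hk₁ : k ≤ γ₁.length) (hk₂ : k ≤ γ₂.length)
    (φ : Site 2 → Site 2 → ℤ) (hφ : ∀ x y, φ y x = -φ x y) :
    ((γ₁.append γ₂.reverse).darts.map fun d => φ d.fst d.snd).sum =
      (((γ₁.drop k).append ((γ₂.drop k).copy (hk k le_rfl).symm rfl).reverse).darts.map
        fun d => φ d.fst d.snd).sum := by
  rw [sum_lens_darts γ₁ γ₂ φ hφ, sum_lens_darts _ _ φ hφ, SimpleGraph.Walk.darts_copy,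
    SimpleGraph.Walk.darts_drop, SimpleGraph.Walk.darts_drop]
  have htake : γ₁.darts.take k = γ₂.darts.take k := by
    have heq : (γ₁.take k).copy rfl (hk k le_rfl) = γ₂.take k := by
      apply SimpleGraph.Walk.ext_support
      rw [SimpleGraph.Walk.support_copy, SimpleGraph.Walk.support_take,
        SimpleGraph.Walk.support_take]
      apply List.ext_getElem
      · simp only [List.length_take, SimpleGraph.Walk.length_support]
        omega
      · intro i h1 h2
        rw [List.getElem_take, List.getElem_take, SimpleGraph.Walk.support_getElem_eq_getVert,
          SimpleGraph.Walk.support_getElem_eq_getVert]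
        exact hk i (by simp only [List.length_take] at h1; omega)
    rw [← SimpleGraph.Walk.darts_take, ← SimpleGraph.Walk.darts_take, ← heq,
      SimpleGraph.Walk.darts_copy]
  rw [← List.sum_take_add_sum_drop (γ₁.darts.map _) k,
    ← List.sum_take_add_sum_drop (γ₂.darts.map _) k, ← List.map_take, ← List.map_take,
    ← List.map_drop, ← List.map_drop, htake]
  ring

/-- The lens loop and the reduced lens loop have the same winding number about every face centre.
[folklore] -/
theorem wind_lens_eq_wind_reduced (hG : ∀ x y, G.Adj x y → (zdGraph 2).Adj x y) {a b : Site 2}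
    (γ₁ γ₂ : G.Walk a b) {k : ℕ} (hk : ∀ i ≤ k, γ₁.getVert i = γ₂.getVert i)
    (hk₁ : k ≤ γ₁.length) (hk₂ : k ≤ γ₂.length) (m k' : ℤ) :
    wind (fun t : ℝ =>
        IccExtend zero_le_one ((γ₁.append γ₂.reverse).toCurve (meshPoint 1)) t - probeL m k') =
      wind (fun t : ℝ => IccExtend zero_le_one
        (((γ₁.drop k).append ((γ₂.drop k).copy (hk k le_rfl).symm rfl).reverse).toCurve
          (meshPoint 1)) t - probeL m k') := by
  rw [wind_loop_probeL hG, wind_loop_probeL hG,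
    sum_lens_eq_sum_reduced γ₁ γ₂ hk hk₁ hk₂ (edgeCross m k') (edgeCross_symm m k')]

/-! ## The four crossing functionals at the edges around a site -/

/-- Across the edge `{p, p + (1,0)}`: vertical counts of the faces `(p₀, p₁-1)` and `(p₀, p₁)`.
[folklore] -/
theorem edgeCross_jump_E (p x y : Site 2) :
    edgeCross (p 0) (p 1 - 1) x y - edgeCross (p 0) (p 1) x y =
      (if x = p ∧ y = bx (p 0 + 1) (p 1) then 1 else 0) -
        (if x = bx (p 0 + 1) (p 1) ∧ y = p then 1 else 0) := by
  rw [eq_bx p, eq_bx x, eq_bx y]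
  simp only [eq_bx_iff, bx_zero, bx_one, edgeCross]
  split_ifs <;> omega

/-- Across the edge `{p - (1,0), p}`: vertical counts of the faces `(p₀-1, p₁-1)` and `(p₀-1, p₁)`.
[folklore] -/
theorem edgeCross_jump_W (p x y : Site 2) :
    edgeCross (p 0 - 1) (p 1 - 1) x y - edgeCross (p 0 - 1) (p 1) x y =
      -((if x = p ∧ y = bx (p 0 - 1) (p 1) then 1 else 0) -
        (if x = bx (p 0 - 1) (p 1) ∧ y = p then 1 else 0)) := by
  rw [eq_bx p, eq_bx x, eq_bx y]
  simp only [eq_bx_iff, bx_zero, bx_one, edgeCross]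
  split_ifs <;> omega

/-- Across the edge `{p, p + (0,1)}`: horizontal counts of the faces `(p₀-1, p₁)` and `(p₀, p₁)`.
[folklore] -/
theorem edgeCross_rot_jump_N (p x y : Site 2) :
    edgeCross (-(p 1) - 1) (p 0 - 1) (bx (-x 1) (x 0)) (bx (-y 1) (y 0)) -
        edgeCross (-(p 1) - 1) (p 0) (bx (-x 1) (x 0)) (bx (-y 1) (y 0)) =
      -((if x = p ∧ y = bx (p 0) (p 1 + 1) then 1 else 0) -
        (if x = bx (p 0) (p 1 + 1) ∧ y = p then 1 else 0)) := by
  rw [eq_bx p, eq_bx x, eq_bx y]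
  simp only [eq_bx_iff, bx_zero, bx_one, edgeCross]
  split_ifs <;> omega

/-- Across the edge `{p - (0,1), p}`: horizontal counts of the faces `(p₀-1, p₁-1)` and
`(p₀, p₁-1)`. [folklore] -/
theorem edgeCross_rot_jump_S (p x y : Site 2) :
    edgeCross (-(p 1 - 1) - 1) (p 0 - 1) (bx (-x 1) (x 0)) (bx (-y 1) (y 0)) -
        edgeCross (-(p 1 - 1) - 1) (p 0) (bx (-x 1) (x 0)) (bx (-y 1) (y 0)) =
      (if x = p ∧ y = bx (p 0) (p 1 - 1) then 1 else 0) -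
        (if x = bx (p 0) (p 1 - 1) ∧ y = p then 1 else 0) := by
  rw [eq_bx p, eq_bx x, eq_bx y]
  simp only [eq_bx_iff, bx_zero, bx_one, edgeCross]
  split_ifs <;> omega

end StepMono

/-- REGISTERED SUB-GOAL `stub_stepMonotoneAux1` of stub `stub_stepMonotone` (this helper file's
main theorem, recorded on the crux item so that the file lands as a `--supports` proof): the
HORIZONTAL PROBE FORMULA — for a closed walk `w` of a lattice subgraph `G ≤ ℤ²`, the winding number
of its polyline about the centre of the face `(m, k)` is the signed count of its vertical darts in
the columns `x ≥ m + 1` between heights `k` and `k + 1` (`+1` northward, `-1` southward), written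
as minus the vertical-probe count of the quarter-turned darts. [folklore] -/
theorem stub_stepMonotoneAux1 : ∀ (G : SimpleGraph (Site 2)),
    (∀ x y, G.Adj x y → (zdGraph 2).Adj x y) → ∀ (u : Site 2) (w : G.Walk u u) (m k : ℤ),
    wind (fun t : ℝ => Set.IccExtend zero_le_one (w.toCurve (meshPoint 1)) t - Negative.probeL m k)
      = -(w.darts.map fun d => Negative.edgeCross (-k - 1) m (Negative.bx (-d.fst 1) (d.fst 0))
        (Negative.bx (-d.snd 1) (d.snd 0))).sum :=
  fun _ hG _ w m k => StepMono.wind_loop_probeL_rot hG w m k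

end Summit.CriticalPhenomena.SAWScalingLimit.Theorems.LeftRightFKG.CornerLoc

end
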